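import Summits.AtomisticToContinuum.Crystallization.Theorems.PricedLinkCensusLocalToGlobalFccMirrorGeometry

/-!
# The canonical cell of the method of images: the open rhombic dodecahedron `fccVoronoi a`

Route `PricedLinkCensus`, crux `LocalToGlobal` (stmt-AtomisticToContinuum-14232), line
`flux-cell-joint-census`, support for the registered stub `stub_fccMirrorExact : NewtonShell8 → FccMirrorExact`
(`Theorems/PricedLinkCensusLocalToGlobalDefs`), second half (`fluxCell ≤ S₆`).  By translation covariance
(`PricedLinkCensusLocalToGlobalFccMirrorGeometry`) the flux cell of a site of an exact fcc patch is the flux cell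
of the CANONICAL data: cell `V = fccVoronoi a`, centre `0`, smearing radius `a/2`, zero transfer
(`fluxCell_eq_canonical`).  This file records the geometry of `V` used by the method of images:

* `mem_fccVoronoi_iff`: `V = ⋂_{m ∈ fccInt} {x : 2⟪x, (a/√2)m⟫ < a²}`, the intersection of the twelve open
  half-spaces of the minimal vectors (the tree's `Literature.Geometry.DiscreteGeometry.fccInt`: all permutations
  of `(±1, ±1, 0)`); hence `V` is open (`isOpen_fccVoronoi`), registered sub-goal `fccMirror_cell_facets`;
* `ball 0 (a/2) ⊆ V ⊆ ball 0 a`; every nonzero `w ∈ fcc(a)` is at distance `> a/2` from `V`, so the smearing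
  balls `B(ι p, a/2)`, `p ∈ fcc(a) ∖ 0`, of the OTHER lattice sites miss the tube `V × ℝ⁵`, while the own ball
  `B(0, a/2) ⊂ ℝ⁸` lies in it.

References: J. H. Conway, N. J. A. Sloane, *Sphere packings, lattices and groups* (1999), Ch. 21; folklore.
-/

noncomputable section

open scoped BigOperators RealInnerProductSpace Pointwise
open MeasureTheory Metric Set Filter Function Literature.Geometry.DiscreteGeometry

namespace Summit.AtomisticToContinuum.Crystallization.Theorems.PricedLinkCensusLocalToGlobal

/-! ### The twelve minimal vectors `fccInt` -/

/-- The minimal vectors have even coordinate sum. [folklore] -/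
theorem even_sum_of_mem_fccInt : ∀ m ∈ fccInt, Even (∑ k, m k) := by decide

/-- The minimal vectors have `Σ mₖ² = 2`. [folklore] -/
theorem sum_sq_of_mem_fccInt {m : Fin 3 → ℤ} (hm : m ∈ fccInt) : (∑ k, ((m k : ℝ)) ^ 2) = 2 := by
  have h := sqNormInt_fccInt m hm
  rw [sqNormInt] at h
  rw [Fin.sum_univ_three]
  exact_mod_cast h

/-- `(a/√2)m ∈ fcc(a)` for `m ∈ fccInt`. [folklore] -/
theorem smul_intVec_mem_fccSet_of_mem_fccInt (a : ℝ) {m : Fin 3 → ℤ} (hm : m ∈ fccInt) :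
    (a / Real.sqrt 2) • intVec m ∈ fccSet a :=
  smul_intVec_mem_fccSet a (even_sum_of_mem_fccInt m hm)

/-- `‖(a/√2)m‖ = a` for `m ∈ fccInt` (`a > 0`). [folklore] -/
theorem norm_smul_intVec_of_mem_fccInt {a : ℝ} (ha : 0 < a) {m : Fin 3 → ℤ} (hm : m ∈ fccInt) :
    ‖(a / Real.sqrt 2) • intVec m‖ = a :=
  norm_smul_intVec_of_sum_sq ha (sum_sq_of_mem_fccInt hm)

/-- From the twelve facet inequalities over `fccInt` to `|uₖ| + |uₗ| < 1` (`u = z/c`). [folklore] -/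
theorem abs_add_abs_lt_of_fccInt {c : ℝ} {z : E3}
    (hf : ∀ m ∈ fccInt, 2 * ∑ k, z k / c * (m k : ℝ) < 2) :
    |z 0 / c| + |z 1 / c| < 1 ∧ |z 0 / c| + |z 2 / c| < 1 ∧ |z 1 / c| + |z 2 / c| < 1 := by
  have e1 := hf ![1, 1, 0] (by decide)
  have e2 := hf ![1, -1, 0] (by decide)
  have e3 := hf ![-1, 1, 0] (by decide)
  have e4 := hf ![-1, -1, 0] (by decide)
  have f1 := hf ![1, 0, 1] (by decide)
  have f2 := hf ![1, 0, -1] (by decide)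
  have f3 := hf ![-1, 0, 1] (by decide)
  have f4 := hf ![-1, 0, -1] (by decide)
  have g1 := hf ![0, 1, 1] (by decide)
  have g2 := hf ![0, 1, -1] (by decide)
  have g3 := hf ![0, -1, 1] (by decide)
  have g4 := hf ![0, -1, -1] (by decide)
  simp [Fin.sum_univ_three] at e1 e2 e3 e4 f1 f2 f3 f4 g1 g2 g3 g4
  exact ⟨abs_add_abs_lt_one (by linarith) (by linarith) (by linarith) (by linarith),
    abs_add_abs_lt_one (by linarith) (by linarith) (by linarith) (by linarith),
    abs_add_abs_lt_one (by linarith) (by linarith) (by linarith) (by linarith)⟩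

/-! ### The cell as the intersection of twelve open half-spaces -/

/-- **`fccVoronoi a = ⋂_{m ∈ fccInt} {z : 2⟪z, (a/√2)m⟫ < a²}`** (`a > 0`). [cite: ConwaySloane1999, Ch. 21 Thm 7] -/
theorem mem_fccVoronoi_iff {a : ℝ} (ha : 0 < a) {z : E3} :
    z ∈ fccVoronoi a ↔ ∀ m ∈ fccInt, 2 * ⟪z, (a / Real.sqrt 2) • intVec m⟫ < a ^ 2 := by
  constructor
  · intro hz m hm
    have hv := norm_smul_intVec_of_mem_fccInt ha hm
    have h := hz _ (smul_intVec_mem_fccSet_of_mem_fccInt a hm) (ne_zero_of_norm_eq' ha hv)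
    rw [norm_lt_norm_sub_iff, hv] at h
    exact h
  · intro h
    set c : ℝ := a / Real.sqrt 2 with hc
    have hf : ∀ m ∈ fccInt, 2 * ∑ k, z k / c * (m k : ℝ) < 2 := fun m hm => by
      have h1 := h m hm
      rw [← norm_smul_intVec_of_mem_fccInt ha hm, facet_iff ha, sum_sq_of_mem_fccInt hm] at h1
      exact h1
    obtain ⟨h01, h02, h12⟩ := abs_add_abs_lt_of_fccInt hf
    intro w hw hw0
    obtain ⟨n, hn, rfl⟩ := mem_fccSet_iff.1 hw
    have hn0 : n ≠ 0 := by
      rintro rfl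
      exact hw0 (by rw [intVec_zero', smul_zero])
    rw [norm_lt_norm_sub_iff, facet_iff ha]
    exact voronoi_core (u := fun k => z k / c) h01 h02 h12 hn hn0
where
  /-- nonzero from the norm -/
  ne_zero_of_norm_eq' {a : ℝ} (ha : 0 < a) {w : E3} (hwa : ‖w‖ = a) : w ≠ 0 := fun h => by
    rw [h, norm_zero] at hwa; exact ha.ne hwa

/-- **The cell is open.** [folklore] -/
theorem isOpen_fccVoronoi {a : ℝ} (ha : 0 < a) : IsOpen (fccVoronoi a) := by
  have hset : fccVoronoi a = ⋂ m ∈ fccInt, {z : E3 | 2 * ⟪z, (a / Real.sqrt 2) • intVec m⟫ < a ^ 2} := by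
    ext z
    rw [mem_fccVoronoi_iff ha]
    simp only [mem_iInter, mem_setOf_eq]
  rw [hset]
  exact isOpen_biInter_finset fun m _ =>
    isOpen_lt (continuous_const.mul (continuous_id.inner continuous_const)) continuous_const

/-- The inner ball: `B(0, a/2) ⊆ fccVoronoi a`. [folklore] -/
theorem ball_subset_fccVoronoi (a : ℝ) : ball (0 : E3) (a / 2) ⊆ fccVoronoi a := by
  intro z hz w hw hw0
  rw [mem_ball_zero_iff] at hz
  have hwa := le_norm_of_mem_fccSet hw hw0
  have htri : ‖w‖ ≤ ‖z - w‖ + ‖z‖ := by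
    have := norm_add_le (w - z) z
    rwa [sub_add_cancel, norm_sub_rev] at this
  linarith

/-- **Other lattice points are far from the cell**: `a/2 < ‖z - w‖` for `z ∈ V`, `w ∈ fcc(a) ∖ 0`
(`‖z‖ < ‖z - w‖` and `‖w‖ ≥ a` give `2‖z - w‖ > ‖w‖`). [folklore] -/
theorem half_lt_norm_sub_of_mem_fccVoronoi {a : ℝ} {z w : E3} (hz : z ∈ fccVoronoi a) (hw : w ∈ fccSet a)
    (hw0 : w ≠ 0) : a / 2 < ‖z - w‖ := by
  have h1 := hz w hw hw0
  have hwa := le_norm_of_mem_fccSet hw hw0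
  have htri : ‖w‖ ≤ ‖z - w‖ + ‖z‖ := by
    have := norm_add_le (w - z) z
    rwa [sub_add_cancel, norm_sub_rev] at this
  linarith

/-! ### The tube over the cell and the smearing balls of `ℝ⁸` -/

/-- **The smearing balls of the other sites miss the tube**: `a/2 < dist z (ι p)` for `z ∈ tube V`,
`p ∈ fcc(a) ∖ 0`. [folklore] -/
theorem half_lt_dist_emb_of_mem_tube {a : ℝ} {z : E8} (hz : z ∈ tube (fccVoronoi a)) {p : E3}
    (hp : p ∈ fccSet a) (hp0 : p ≠ 0) : a / 2 < dist z (emb p) := by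
  have h1 : a / 2 < ‖proj z - p‖ := half_lt_norm_sub_of_mem_fccVoronoi hz hp hp0
  have h2 : ‖proj z - p‖ ≤ ‖z - emb p‖ := by rw [← proj_sub_emb]; exact norm_proj_le _
  rw [dist_eq_norm]
  linarith

/-- Points of the smearing ball of another site are not in the tube. [folklore] -/
theorem not_mem_tube_of_mem_ball {a : ℝ} {p : E3} (hp : p ∈ fccSet a) (hp0 : p ≠ 0) {z : E8}
    (hz : z ∈ ball (emb p) (a / 2)) : z ∉ tube (fccVoronoi a) := fun h => by
  have := half_lt_dist_emb_of_mem_tube h hp hp0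
  rw [mem_ball] at hz
  linarith

/-- **The own smearing ball lies in the tube**: `B(0, a/2) ⊆ tube (fccVoronoi a)` in `ℝ⁸`. [folklore] -/
theorem ball_zero_subset_tube (a : ℝ) : ball (0 : E8) (a / 2) ⊆ tube (fccVoronoi a) := by
  intro z hz
  have h : z ∈ ball (emb (0 : E3)) (a / 2) := by rwa [emb_zero]
  exact ball_subset_fccVoronoi a (proj_mem_ball_of_mem_ball h)

/-- The tube over the cell is open. [folklore] -/
theorem isOpen_tube_fccVoronoi {a : ℝ} (ha : 0 < a) : IsOpen (tube (fccVoronoi a)) :=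
  (isOpen_fccVoronoi ha).preimage (projL : E8 →L[ℝ] E3).continuous

/-! ### Reduction of the flux cell of an fcc patch to the canonical data -/

section Patch

variable {N : ℕ} {a ρ₀ : ℝ} {y : Fin N → E3} {i : Fin N}

/-- **The flux cell of a site of an exact fcc patch is the flux cell of the canonical cell**:
`fluxCell (cell ρ₀ y i) (y i) (a/2) 0 = fluxCell (fccVoronoi a) 0 (a/2) 0`. [folklore] -/
theorem fluxCell_eq_canonical (ha : 0 < a) (hρ₀ : 1 ≤ ρ₀) (hy : Injective y)
    (h1 : ∀ j, dist (y j) (y i) ≤ 3 * ρ₀ * a → y j - y i ∈ fccSet a)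
    (h2 : ∀ p ∈ fccSet a, ‖p‖ ≤ 3 * ρ₀ * a → ∃ j, y j = y i + p) :
    fluxCell (cell ρ₀ y i) (y i) (a / 2) (fun _ => 0) = fluxCell (fccVoronoi a) 0 (a / 2) (fun _ => 0) := by
  rw [cell_eq_vadd_fccVoronoi ha hρ₀ hy h1 h2]
  have h := fluxCell_translate (isOpen_fccVoronoi ha) 0 (y i) (a / 2)
  rwa [zero_add] at h

end Patch

/-- **Registered sub-goal `fccMirror_cell_facets`** (line `flux-cell-joint-census`, support of
`stub_fccMirrorExact`): the open rhombic dodecahedron is the intersection of the twelve open half-spaces of the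
minimal vectors, binder form of `mem_fccVoronoi_iff`. [cite: ConwaySloane1999, Ch. 21 Thm 7] -/
theorem fccMirror_cell_facets : ∀ (a : ℝ), 0 < a → ∀ z : E3,
    z ∈ fccVoronoi a ↔ ∀ m ∈ fccInt, 2 * ⟪z, (a / Real.sqrt 2) • intVec m⟫ < a ^ 2 :=
  fun _ ha _ => mem_fccVoronoi_iff ha

end Summit.AtomisticToContinuum.Crystallization.Theorems.PricedLinkCensusLocalToGlobal

end
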